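import Summits.BirchSwinnertonDyer.BirchSwinnertonDyer.Theorems.GenusKolyvaginAtTwoGenusPrimitiveSupplyAtTwoTranspositionTwistLaw
import Summits.BirchSwinnertonDyer.BirchSwinnertonDyer.Theorems.ByReductionTypeAtTwoRankOneAtTwoBigImageOddLocalOneDoorSubsliceFirstLayerManinFree
import Literature.NumberTheory.EllipticCurves.BSDSelmerSmithHigherSelmerRankLaws
import HarnessLib

/-!
# ES-46 (seed) — `Δ < 0`: THE FROBENIUS-SELECTED PLANE AT ONE-TRANSPOSITION DOORS (-es g36, Euler-system / explicit-reciprocity lens;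
crux 23715 `RankOneAtTwoBigImageOddLocal`, residue `R_S` = `DoorIndexLawFullCAtTwoSomeDoorResidueSha`, the `Δ_W < 0` half)

WORKFILE of the cell `bsd-f1-sign2` (planner seat `-es`), written with `ledger crux write stmt-BirchSwinnertonDyer-23715 ShaTranspositionAtTwoES46.lean`.
Nothing here is a tree theorem about BSD; BSD is not proved by any of this.  VERSION v0.3 (-es g37, 2026-08-31T09:45Z): v0.2 (92d27a76ab8e7471, commit 2daec4b8a272, AUDITED REF1 §448: survive,
BC7 CLEAN) + rider R448c (Cassels alternation cited in `ShaTwoPrimaryCardFour`, VIS⁻, S3″; docstrings only — every declaration byte-identical); R448b/R448d recorded: the shared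
vocabulary module and the lemmas K448.2b (`twistSelmerTwoCard_const`, door-independence on the `Δ > 0` side) / K448.3 (`selmerTwoVisibleAtPrime_iff_not_strict`) live in
REF1-data/b448 and are to be merged when the typer's T46-1 lands.  VERSION v0.2 (2026-08-31T08:30Z): v0.1 + §3 = storey 1 of `R_S ∩ {Δ < 0}` TYPED AND KERNEL-REDUCED (S1″–S3″ + `residueShaTranspFour_of_transpShaSpinDoors`).
VERSION v0.1 (seed, 2026-08-31T08:00Z; v0 = commit 2b921d127a29 with VIS⁻ over `¬ ShaTwoTrivial`, narrowed here per REF1 R444b): vocabulary + the PROVED directed counts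
for ANY `Ш` + one conjecture (VIS⁻); §3 (v0.2) types storey 1 of `R_S ∩ {Δ < 0, #Ш[2^∞] = 4}` and kernel-reduces it to S1″–S3″
(= ES-45 §2–§3 under the dictionary `∞ ↦ q₀`, `MeetsEgg ↦ SelmerTwoVisibleAtPrime`, `DescAdmissible d ↦ TranspAdmissible d q₀`).

THE MECHANISM (the cell's dictionary `q₀ (Δ < 0) ↔ ∞ (Δ > 0)`, MEMO-es §18; tree THEOREM T-q₀ `transpositionTwistLawAtTwo_holds` is its `Ш(W)[2] = 0` case).
For `Δ_W < 0` the real place carries NO condition (`H¹(ℝ, E[2]) = 0`: complex conjugation acts on `E[2]` as a transposition, a free `𝔽₂[C₂]`-module);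
at a transposition-admissible door `(d, q₀)` (`d ≡ 1 (8)`, door primes good, all but `q₀` with `a_q` odd, `(d/ℓ) = +1` at odd bad `ℓ`, `Frob_{q₀}` a
transposition) the local conditions of `Sel₂(W)` and `Sel₂(W^{(d)})` in `H¹(ℚ, E[2])` differ ONLY at `q₀`, where `dim H¹(ℚ_{q₀}, E[2]) = 2` and the two
Kummer lines are transverse (Mazur–Rubin Lemma 2.11).  Hence (Poitou–Tate sandwich of index `2` at `q₀`), for ANY rank and ANY `Ш`:
DOWN `#Sel₂(W^{(d)}) = #Sel₂(W)/2` iff some Selmer class is non-trivial at `q₀`, UP `#Sel₂(W^{(d)}) = 2·#Sel₂(W)` iff `Sel₂(W)` is strict at `q₀`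
(`twistSelmerTwoCard_directed_of_transpAdmissible`, PROVED below from the tree engine `natCard_selmerGroup_twist_directed_of_menu_frame`).
DIFFERENCE FROM `Δ > 0` (ES-45): the plane `Sel₂(W^{(d)}) = ker(λ_{q₀} | Sel₂(W))` is NOT inherited — it is SELECTED by `Frob_{q₀}` in the finite
SELMER FIELD `L_W = ℚ(E[2], Sel₂(W))` (first Chebotarev datum: which functional `λ_{q₀} ∈ Sel₂(W)^∨`; `λ_{q₀}(κ_g) ≠ 0 ⟺ ḡ ∉ 2Ẽ(𝔽_{q₀})` =
`MeetsNonNormAt W q₀`); the Cassels–Tate bit `β` on the selected plane is the second datum.  For rank one, `E(ℚ)[2] = 0`, `#Ш(W)[2^∞] = 4` and a DOWN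
door: `Sel₂(W^{(d)}) ≅ Ш(W)[2]` by projection (a complement of `⟨κ_g⟩` when `ḡ ∉ 2Ẽ(𝔽_{q₀})`), `W^{(d)}(ℚ)[2] = 0`, rank `W^{(d)} ∈ {0, 2}`;
`β = 1` ⟹ rank `0`, `Ш(W^{(d)})[2^∞] = (ℤ/2)²`, one-door law (one transverse place) `m = v₂(c) + 2`; `β = 0` ⟹ rank-`2` twist with `Ш(W)[2]`
Mordell–Weil-visible in `E × E^{(d)}`, or `Ш(W^{(d)}) ⊇ (ℤ/4)²`.

CENSUS46-pilot (`CensusES46pilot.md`; pure python over ecdata; predictions P7–P12 frozen first): 72 348 candidate `W` (`Δ < 0`; 16 with `Ш_an = 4`),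
2 299 one-transposition twin rows (`N·d² < 5·10⁵`, POP-A `d ≡ 1 (8)` and POP-B `d ≡ 5 (8)`, `N` odd), 0 missing, **0 violations**: controls `Ш_an` odd —
DOWN rows (`ḡ ∉ 2Ẽ(𝔽_{q₀})`) 1 608 × `(r_d, v₂Ш_an(W^d)) = (0,0)`; UP rows 688, all of `Sel₂`-dimension `2` (`(2,0)` 585, `(0,2)` 96, `(0,4)` 7), never `(0,0)`;
`Ш_an = 4` rows: 3, all DOWN at `d = −3` (POP-B, `q₀ = 3`): `37687a1 → 339183d1` and `53083b1 → 477747a1` rank `2`, `Ш_an = 1` (MW-VISIBLE `Ш(W)[2]`),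
`35083b1 → 315747d1` rank `0`, `Ш_an = 16` — the DOWN count PREDICTS `dim Sel₂(315747d1) = 2`, i.e. `Ш(315747d1) ≅ (ℤ/4)²` not `(ℤ/2)⁴` (data ask D-es-116).
(The tree's `TranspAdmissible` is POP-A; the POP-B rows test the same sandwich with the unramified condition at `2`.)
-/

noncomputable section

open scoped Classical ContRepresentation

set_option linter.dupNamespace false
set_option autoImplicit false

namespace Summit.BirchSwinnertonDyer.BirchSwinnertonDyer.Theorems.RankOneAtTwoShaTranspositionAtTwo

open WeierstrassCurve Field NumberField IsDedekindDomain Function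
open Literature.NumberTheory.EllipticCurves Literature.NumberTheory.GaloisRepresentations
open Literature.NumberTheory.GaloisRepresentations.IsNonarchimedeanLocalField
open Literature.NumberTheory.GaloisCohomology
open Rat.HeightOneSpectrum (primesEquiv natGenerator)
open Summit.BirchSwinnertonDyer.Rank1Residual.F1Sign2
open Summit.BirchSwinnertonDyer.Rank1Residual.F1Sign2.TranspositionDoor (TranspAdmissible MeetsNonNormAt TranspositionTwistLawAtTwo)
open Summit.BirchSwinnertonDyer.BirchSwinnertonDyer.Theorems.GenusKolyTwistLocal
open Summit.BirchSwinnertonDyer.BirchSwinnertonDyer.Theorems.GenusKolyArch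
open Summit.BirchSwinnertonDyer.BirchSwinnertonDyer.Theorems.GenusKolyTwistingPrime (primesEquiv_eq natCast_not_mem_of_not_dvd)
open Summit.BirchSwinnertonDyer.BirchSwinnertonDyer.Theorems.GenusKolyTwistRamified
open Summit.BirchSwinnertonDyer.BirchSwinnertonDyer.Theorems.GenusKolyTransp
open Summit.BirchSwinnertonDyer.BirchSwinnertonDyer.Theorems.RankOneAtTwoOneDoor (natCard_ker_nsmul_adicCompletion_two_eq_two_of_jacobiSym)
open Literature.NumberTheory.EllipticCurves.ModularForms
open Summit.BirchSwinnertonDyer.BirchSwinnertonDyer.Theses.ByReductionTypeAtTwo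

universe u

/-! ## §0 Vocabulary -/

/-- **`Sel₂(W)` VISIBLE AT THE PRIME `q`**: at (every =) the place `v ∋ q` some `2`-Selmer class of `W` localises non-trivially.  For an odd good
prime with `#Ẽ(𝔽_q)[2] = 2` and a rational point `P` with `P̄ ∉ 2Ẽ(𝔽_q)` (`MeetsNonNormAt W q`) the Kummer class of `P` is such a class
(`selmerTwoVisibleAtPrime_of_meetsNonNormAt`); in rank one with `E(ℚ)[2] = 0` and `Ш(W)[2] ≠ 0` a `Ш`-class may be visible at `q` even when
`κ_g` is not.  The `Δ < 0` analogue of ES-45's `SelmerTwoVisibleAtInfinity`; DOOR-DEPENDENT (a Chebotarev condition on `Frob_q` in the Selmer field). -/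
def SelmerTwoVisibleAtPrime (W : WeierstrassCurve ℚ) [W.IsElliptic] (q : ℕ) : Prop :=
  ∀ v : HeightOneSpectrum (𝓞 ℚ), (q : 𝓞 ℚ) ∈ v.asIdeal →
    ∃ c ∈ (W.kummerSelmerStructure ((2 : ℕ) : ℤ)).selmerGroup,
      galoisCohomology.localization (W.torsionGaloisModule ((2 : ℕ) : ℤ)) (Sum.inr v) 1 c ≠ 0

/-- **`Sel₂(W)` STRICT AT THE PRIME `q`**: at (every =) the place `v ∋ q` every `2`-Selmer class localises to `0`.  (Exactly one of
`SelmerTwoVisibleAtPrime W q`, `SelmerTwoStrictAtPrime W q` holds, the place over `q` being unique; not recorded as a lemma here.) -/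
def SelmerTwoStrictAtPrime (W : WeierstrassCurve ℚ) [W.IsElliptic] (q : ℕ) : Prop :=
  ∀ v : HeightOneSpectrum (𝓞 ℚ), (q : 𝓞 ℚ) ∈ v.asIdeal →
    ∀ c ∈ (W.kummerSelmerStructure ((2 : ℕ) : ℤ)).selmerGroup,
      galoisCohomology.localization (W.torsionGaloisModule ((2 : ℕ) : ℤ)) (Sum.inr v) 1 c = 0

variable (W : WeierstrassCurve ℚ) [W.IsElliptic] [W.IsGloballyMinimal] [W.IsIntegral ℤ]

/-- The place of `ℚ` over a rational prime exists (bookkeeping for the two predicates). -/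
theorem exists_place_of_prime {q : ℕ} (hq : q.Prime) : ∃ v : HeightOneSpectrum (𝓞 ℚ), (q : 𝓞 ℚ) ∈ v.asIdeal :=
  ⟨primesEquiv.symm ⟨q, hq⟩, by
    have h := Rat.HeightOneSpectrum.natCast_natGenerator_mem (primesEquiv.symm ⟨q, hq⟩)
    rwa [show natGenerator (primesEquiv.symm ⟨q, hq⟩) = q from
      congrArg Subtype.val (primesEquiv.apply_symm_apply (⟨q, hq⟩ : Nat.Primes))] at h⟩

/-- **`MeetsNonNormAt W q₀ ⟹ Sel₂(W)` visible at `q₀`** at a transposition-admissible door (the Kummer reading of the door, tree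
`exists_mem_selmerGroup_localization_ne_zero_of_meetsNonNormAt`; any rank, any `Ш`). [cite: Kramer1981, Prop. 3] -/
theorem selmerTwoVisibleAtPrime_of_meetsNonNormAt {d : ℤ} {q₀ : ℕ} [Fact q₀.Prime] (hadm : TranspAdmissible W d q₀)
    (h : MeetsNonNormAt W q₀) : SelmerTwoVisibleAtPrime W q₀ := by
  intro v hv
  obtain ⟨-, -, hd8, hq₀, hq₀d, -, hprimes, -⟩ := hadm
  have hq₀2 : q₀ ≠ 2 := by
    rintro rfl
    have h2d : (2 : ℤ) ∣ d := by exact_mod_cast hq₀d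
    omega
  have hgood₀ : W.HasGoodReductionAtPrime q₀ := (hprimes q₀ hq₀ hq₀d).1 inferInstance
  have hq₀Δ : ¬ (q₀ : ℤ) ∣ minimalDiscriminantInt W := W.not_dvd_minimalDiscriminantInt_of_hasGoodReductionAtPrime' _ hgood₀
  exact exists_mem_selmerGroup_localization_ne_zero_of_meetsNonNormAt W v hv hq₀2 hq₀Δ h

/-! ## §1 THE DIRECTED COUNTS AT A ONE-TRANSPOSITION DOOR — any rank, any `Ш` (PROVED) -/

omit [W.IsElliptic] [W.IsGloballyMinimal] [W.IsIntegral ℤ] in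
/-- **UP / DOWN AT `q₀` FOR `Δ < 0`, UNCONDITIONAL, ANY `Ш`** (the tree's proof of T-q₀ with the last two lines removed): `W/ℚ` globally minimal
elliptic with `Δ_W < 0`, `(d, q₀)` transposition-admissible, `v₀` the place over `q₀`.  If `Sel₂(W)` is strict at `v₀` then
`#Sel₂(W^{(d)}) = 2·#Sel₂(W)`; if some Selmer class is non-trivial at `v₀` then `2·#Sel₂(W^{(d)}) = #Sel₂(W)`.
[cite: MazurRubin2010, Prop. 3.3 and Cor. 3.4 (i), Lemmas 2.9–2.11] [cite: Kramer1981, Prop. 3 and Thm. 1] [cite: MilneADT2006, I Thm. 2.8, 4.10] -/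
theorem twistSelmerTwoCard_directed_at_place (W : WeierstrassCurve ℚ) [W.IsElliptic] [W.IsGloballyMinimal] [W.IsIntegral ℤ]
    (hΔ : W.Δ < 0) {d : ℤ} {q₀ : ℕ} [Fact q₀.Prime] (hadm : TranspAdmissible W d q₀)
    (v₀ : HeightOneSpectrum (𝓞 ℚ)) (hv₀ : (q₀ : 𝓞 ℚ) ∈ v₀.asIdeal) :
    ((∀ c ∈ (W.kummerSelmerStructure ((2 : ℕ) : ℤ)).selmerGroup,
        galoisCohomology.localization (W.torsionGaloisModule ((2 : ℕ) : ℤ)) (Sum.inr v₀) 1 c = 0) →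
      twistSelmerTwoCard W d = 2 * selmerTwoCard W) ∧
    ((∃ c ∈ (W.kummerSelmerStructure ((2 : ℕ) : ℤ)).selmerGroup,
        galoisCohomology.localization (W.torsionGaloisModule ((2 : ℕ) : ℤ)) (Sum.inr v₀) 1 c ≠ 0) →
      2 * twistSelmerTwoCard W d = selmerTwoCard W) := by
  have hd := hadm
  obtain ⟨hdneg, hsf, hd8, hq₀, hq₀d, hjac, hprimes, -⟩ := hadm
  have hq₀2 : q₀ ≠ 2 := by
    rintro rfl
    have h2d : (2 : ℤ) ∣ d := by exact_mod_cast hq₀d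
    omega
  have hn2 : ¬ q₀ ∣ 2 := fun h ↦ hq₀2 ((Nat.prime_dvd_prime_iff_eq hq₀ Nat.prime_two).mp h)
  have hgood₀ : W.HasGoodReductionAtPrime q₀ := (hprimes q₀ hq₀ hq₀d).1 inferInstance
  have hq₀Δ : ¬ (q₀ : ℤ) ∣ minimalDiscriminantInt W := W.not_dvd_minimalDiscriminantInt_of_hasGoodReductionAtPrime' _ hgood₀
  have hq₀Δ' : ¬ (q₀ : ℤ) ∣ W.Δ.num := by rwa [← cast_minimalDiscriminantInt W, Rat.num_intCast]
  have h2v₀ : ((2 : ℕ) : 𝓞 ℚ) ∉ v₀.asIdeal := natCast_not_mem_of_not_dvd hq₀ hv₀ hn2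
  have hv₀W : W.HasGoodReductionAt v₀ := by
    obtain hpq := primesEquiv_eq hq₀ hv₀
    subst hpq
    exact (hasGoodReductionAtPrime_iff_hasGoodReductionAt_ringOfIntegers v₀ W).mp hgood₀
  have hram : closureEmb (K := ℚ) (v₀.adicCompletion ℚ) (geomSqrt ((d : ℤ) : ℚ)) ∉ maxUnramified (v₀.adicCompletion ℚ) := by
    apply closureEmb_geomSqrt_not_mem_maxUnramified_rat v₀
    obtain ⟨m, hm⟩ := hq₀d
    have hqm : ¬ (q₀ : ℤ) ∣ m := fun hm' ↦ by
      have hsq : (q₀ : ℤ) * q₀ ∣ d := by rw [hm]; exact mul_dvd_mul_left _ hm'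
      have hu := hsf _ hsq
      rw [Int.isUnit_iff] at hu
      rcases hu with hu | hu
      · exact hq₀.one_lt.ne' (by exact_mod_cast hu)
      · have : (0 : ℤ) ≤ (q₀ : ℤ) := by positivity
        omega
    rw [show ((d : ℤ) : ℚ) = ((q₀ : ℕ) : ℚ) * ((m : ℤ) : ℚ) by rw [hm]; push_cast; ring, Valuation.map_mul,
      valuation_natCast_eq_exp_neg_one_of_mem v₀ hq₀ hv₀, valuation_intCast_eq_one_of_not_dvd (K := ℚ) (v := v₀) hq₀ hv₀ hqm,
      mul_one]
  have ht : Nat.card (nsmulAddMonoidHom 2 : (W.baseChange (v₀.adicCompletion ℚ)).toAffine.Point →+ _).ker = 2 :=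
    natCard_ker_nsmul_adicCompletion_two_eq_two_of_jacobiSym W hq₀2 hgood₀ hq₀Δ' hjac hv₀
  have hd0 : d ≠ 0 := hdneg.ne
  have hdQ : ((d : ℤ) : ℚ) ≠ 0 := by exact_mod_cast hd0
  haveI := W.isElliptic_quadraticTwist hdQ
  set Wd : WeierstrassCurve ℚ := W.quadraticTwist ((d : ℤ) : ℚ) with hWd
  have hC : (1 : VariableChange ℚ) • W.quadraticTwist ((d : ℤ) : ℚ) = Wd := one_smul _ _
  obtain ⟨φ, ψ, hψφ, hφψ, -⟩ := exists_intertwining_hsplit W hdQ hC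
  have hfin := transpAdmissible_place_menu W hd hv₀ hC φ ψ hψφ hφψ
  have hinf : ∀ w : InfinitePlace ℚ,
      (∃ s : w.Completion, s ^ 2 = algebraMap ℚ w.Completion ((d : ℤ) : ℚ)) ∨
      ((∀ y : galoisCohomology (W.localGaloisModule w.Completion) 1, y = 0) ∧
        (∀ y : galoisCohomology (Wd.localGaloisModule w.Completion) 1, y = 0)) := by
    intro w
    right
    have hneg' : Wd.Δ < 0 := by
      rw [hWd, quadraticTwist_Δ]
      exact mul_neg_of_pos_of_neg (by positivity) hΔ
    exact ⟨fun y ↦ GenusExact.ArchVanishing.localH1_infinitePlace_eq_zero_of_Δ_neg W w hΔ y,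
      fun y ↦ GenusExact.ArchVanishing.localH1_infinitePlace_eq_zero_of_Δ_neg _ w hneg' y⟩
  obtain ⟨hup, hdown⟩ := natCard_selmerGroup_twist_directed_of_menu_frame W Wd hdQ hC v₀ h2v₀ hv₀W hram ht hfin hinf
  have hSelW : Nat.card (W.selmerGroup ((2 : ℕ) : ℤ)) = selmerTwoCard W := by
    rw [Nat.cast_ofNat]; rfl
  have hmodel : Nat.card (Wd.selmerGroup ((2 : ℕ) : ℤ)) = twistSelmerTwoCard W d := by
    rw [Nat.cast_ofNat]
    exact GenusKolyTwin.natCard_selmerGroup_model_eq_twistSelmerTwoCard W hd0 Wd ⟨1, hC⟩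
  rw [hSelW, hmodel] at hup hdown
  exact ⟨fun hstr ↦ by have h := hup hstr; omega, fun hvis ↦ by have h := hdown hvis; omega⟩

/-- **DOWN at a one-transposition door, any `Ш`**: `Δ_W < 0`, `(d, q₀)` transposition-admissible, `Sel₂(W)` visible at `q₀` ⟹
`2·#Sel₂(W^{(d)}) = #Sel₂(W)`.  For rank one with `E(ℚ)[2] = 0` (`#Sel₂(W) = 2·#Ш(W)[2]`, ES-45 `selmerTwoCard_eq_two_mul_shaTwoTorsionCard_of_rankOne`)
this is `#Sel₂(W^{(d)}) = #Ш(W)[2]` — the `Ш`-SELECTED PLANE at `q₀`. -/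
theorem two_mul_twistSelmerTwoCard_eq_selmerTwoCard_of_visibleAtPrime (hΔ : W.Δ < 0) {d : ℤ} {q₀ : ℕ} [Fact q₀.Prime]
    (hadm : TranspAdmissible W d q₀) (hvis : SelmerTwoVisibleAtPrime W q₀) :
    2 * twistSelmerTwoCard W d = selmerTwoCard W := by
  obtain ⟨v₀, hv₀⟩ := exists_place_of_prime hadm.2.2.2.1
  exact (twistSelmerTwoCard_directed_at_place W hΔ hadm v₀ hv₀).2 (hvis v₀ hv₀)

/-- **UP at a one-transposition door, any `Ш`**: `Δ_W < 0`, `(d, q₀)` transposition-admissible, `Sel₂(W)` strict at `q₀` ⟹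
`#Sel₂(W^{(d)}) = 2·#Sel₂(W)` (`= 4·#Ш(W)[2]` in rank one with `E(ℚ)[2] = 0`: no depth-two door there). -/
theorem twistSelmerTwoCard_eq_two_mul_selmerTwoCard_of_strictAtPrime (hΔ : W.Δ < 0) {d : ℤ} {q₀ : ℕ} [Fact q₀.Prime]
    (hadm : TranspAdmissible W d q₀) (hstr : SelmerTwoStrictAtPrime W q₀) :
    twistSelmerTwoCard W d = 2 * selmerTwoCard W := by
  obtain ⟨v₀, hv₀⟩ := exists_place_of_prime hadm.2.2.2.1
  exact (twistSelmerTwoCard_directed_at_place W hΔ hadm v₀ hv₀).1 (hstr v₀ hv₀)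

/-- **DOWN when the generator meets the non-norm coset** (`ḡ ∉ 2Ẽ(𝔽_{q₀})`; the census's `lam = 1` rows, 1 608 + 3 of them): any `Ш`. -/
theorem two_mul_twistSelmerTwoCard_eq_selmerTwoCard_of_meetsNonNormAt (hΔ : W.Δ < 0) {d : ℤ} {q₀ : ℕ} [Fact q₀.Prime]
    (hadm : TranspAdmissible W d q₀) (h : MeetsNonNormAt W q₀) :
    2 * twistSelmerTwoCard W d = selmerTwoCard W :=
  two_mul_twistSelmerTwoCard_eq_selmerTwoCard_of_visibleAtPrime W hΔ hadm (selmerTwoVisibleAtPrime_of_meetsNonNormAt W hadm h)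

/-! ## §2 The one typed candidate of the seed -/

omit W

/-- `#Ш(W)[2^∞] = 4` (verbatim copy of ES-45's `ShaTwoPrimaryCardFour`, pending a shared defs file — REF1 R448b; REF1 R444b: the visibility statements are typed on this
storey only). R448c (gen 37, REF1 §448; REF2 v73-add13 ZZ4): the step «`#Ш[2^∞] = 4 ⟹ Ш[2^∞] = Ш[2] ≅ (ℤ/2)²`» is CASSELS ALTERNATION — for an elliptic curve over a number field the Cassels–Tate pairing on `Ш` is ALTERNATING with kernel the divisible subgroup, so a finite `Ш[2^∞]` is `M ⊕ M` and order `4` forces `(ℤ/2)²` (`ℤ/4` carries no non-degenerate alternating form); special to elliptic curves / polarisations from rational divisors (in general only antisymmetric, Poonen–Stoll). [cite: Cassels1962, §3 (the pairing on Ш is alternating; kernel = divisible part)] [cite: MilneADT2006, Thm. I.6.13, Cor. I.6.14] -/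
def ShaTwoPrimaryCardFour (W : WeierstrassCurve ℚ) [W.IsElliptic] : Prop :=
  Nat.card (AddCommGroup.primaryComponent W.sha 2) = 4

/-- **VIS⁻ `ShaTwoMordellWeilVisibleAtSomeTranspositionDoor` (CONJECTURE; census46-pilot 2/3 `Ш_an = 4` rows, both at `d = −3`).**  `Δ_W < 0`, rank one,
`E(ℚ)[2] = 0`, `#Ш(W)[2^∞] = 4` (REF1 R444b: this storey only): SOME transposition-admissible door has trivial `Sel₂`-defect, `#Sel₂(W^{(d)}) = 2^{rank W^{(d)}}` — at a DOWN door
(§1) this says `rank W^{(d)} = dim Ш(W)[2]`, `Ш(W^{(d)})[2] = 0`, and every class of `Ш(W)[2]` is the image in `H¹(ℚ, E)` of a Kummer class of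
`W^{(d)}`: `Ш(W)[2]` is Mordell–Weil-visible in `E × E^{(d)}` (at an UP door it would force rank `W^{(d)} = 2 + dim Ш(W)[2]`; `dim Ш(W)[2] = 2` by Cassels alternation, R448c, [cite: Cassels1962, §3 (the pairing on Ш is alternating; kernel = divisible part)] [cite: MilneADT2006, Thm. I.6.13, Cor. I.6.14]).  Why it might fail: asks
for rank-`dim Ш(W)[2]` twists inside a thin Chebotarev family for EVERY such `W` — believed, unproved; recorded as the lens's reading of the data, not a
crux.  The POP-B witnesses (`d = −3`) lie outside the tree's `TranspAdmissible` (`d ≡ 1 (8)`); POP-A witnesses need `N·49 > 5·10⁵` twins (D-es-116).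
[cite: CremonaMazur2000, §3] [cite: Kramer1981, Prop. 3] [cite: MazurRubin2010, Cor. 3.4 (i)] -/
@[conjecture] def ShaTwoMordellWeilVisibleAtSomeTranspositionDoor : Prop :=
  ∀ (W : WeierstrassCurve ℚ) [W.IsElliptic] [W.IsGloballyMinimal],
    W.Δ < 0 → NoRationalTwoTorsion W → W.mordellWeilRank = 1 → ShaTwoPrimaryCardFour W →
    ∃ (d : ℤ) (q₀ : ℕ), TranspAdmissible W d q₀ ∧
      twistSelmerTwoCard W d = 2 ^ (W.quadraticTwist (d : ℚ)).mordellWeilRank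


/-! ## §3 (v0.2) STOREY 1 OF `R_S ∩ {Δ < 0}`: the typed statements S1″–S3″ and the kernel reduction -/

open Summit.BirchSwinnertonDyer.BirchSwinnertonDyer.Theorems
open Summit.BirchSwinnertonDyer.BirchSwinnertonDyer.Theorems.RankOneAtTwoOneDoor

/-- `r_4(W^{(d)}) = 0` (verbatim ES-44/ES-45 §0 `SpinNondegenerateAt`): on a DOWN door of the storey (`Sel₂(W^{(d)}) ≅ (ℤ/2)²`, `W^{(d)}(ℚ)[2] = 0`) this is the
Cassels–Tate bit `β = 1`: rank `0` and `Ш(W^{(d)})[2^∞] = (ℤ/2)²`. [cite: SmithGoldfeld2025, Notation 1.8] -/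
def SpinNondegenerateAt (W : WeierstrassCurve ℚ) (d : ℤ) : Prop :=
  twistSelmerTorsionRankPow W 2 d = 0

/-- `#Ш[2^∞] = 4 ⟹ Ш[2] ≠ 0` (verbatim ES-45 §1). -/
theorem not_shaTwoTrivial_of_shaTwoPrimaryCardFour (W : WeierstrassCurve ℚ) [W.IsElliptic] (h4 : ShaTwoPrimaryCardFour W) :
    ¬ ShaTwoTrivial W := by
  intro hSha
  have h0 := padicValNat_card_primaryComponent_sha_two_eq_zero_of_shaTwoTrivial W hSha
  rw [show Nat.card (AddCommGroup.primaryComponent W.sha 2) = 4 from h4] at h0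
  have : padicValNat 2 4 = 2 := by
    rw [show (4 : ℕ) = 2 ^ 2 by norm_num, padicValNat.prime_pow]
  omega

/-- **THE RESTRICTED RESIDUE `R_S|{Δ<0, #Ш[2^∞]=4}`** (`DoorIndexLawFullCAtTwoSomeDoorResidueShaTranspFour`; CONJECTURE = the target of §3's reduction): every
curve of crux 23715's slice with `Δ_W < 0` and `#Ш(W)[2^∞] = 4` admits a LAWFUL door datum.  A sub-case of the line of record's `R_S`
(`residueShaTranspFour_of_residueSha`).  Unlike the `Δ > 0` storey no visibility binder is needed at the residue level: the DOWN door is CHOSEN (S1″).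
[cite: GrossLMS1991, Conj. 1.2 and §3] [cite: MazurRubin2010, Prop. 3.3] -/
@[conjecture] def DoorIndexLawFullCAtTwoSomeDoorResidueShaTranspFour : Prop :=
  ∀ (W : WeierstrassCurve ℚ) [W.IsElliptic] [W.IsGloballyMinimal] [NeZero (W.conductorNorm ℤ)],
    ¬ W.HasCM → (∀ n : ℕ, W.HasSurjectiveModNGaloisRep ((2 ^ n : ℕ) : ℤ)) → Odd W.torsionOrder → Odd W.tamagawaProduct →
    W.analyticRank = 1 → W.Δ < 0 → ShaTwoPrimaryCardFour W → HasLawfulDoorAtTwo W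

/-- `R_S ⟹` the restricted residue. -/
theorem residueShaTranspFour_of_residueSha (h : DoorIndexLawFullCAtTwoSomeDoorResidueSha) :
    DoorIndexLawFullCAtTwoSomeDoorResidueShaTranspFour := by
  intro W _ _ _ hCM hsurj hT hc hr _ h4
  exact h W hCM hsurj hT hc hr (not_shaTwoTrivial_of_shaTwoPrimaryCardFour W h4)

/-- **S1″ `TranspShaSpinDoorExistsAtTwo` (CONJECTURE; supply).**  Every `W` of the class (`Δ_W < 0`, `#Ш(W)[2^∞] = 4`, slice binders) has an imaginary quadratic `K`
and a prime `q₀` with `(d_K, q₀)` TRANSPOSITION-admissible, `Sel₂(W)` VISIBLE at `q₀` (DOWN door: `Sel₂(W^{(d_K)}) = ker λ_{q₀} ≅ (ℤ/2)²`), SPIN-NONDEGENERATE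
(`r_4(W^{(d_K)}) = 0`, the CT bit `β = 1`) and `L(W^{(d_K)}, 1) ≠ 0`.  Two Chebotarev data in the Selmer field and its governing extension + the rank-`0`
`2`-converse.  BC5 status: NO witness in the ecdata range (census46-pilot: the 3 in-range DOWN rows of `Ш_an = 4` curves are POP-B `d = −3`, outside
`TranspAdmissible`, and have `β = 0`) — plan-only, data ask D-es-116 (b).  Why it might fail: `β ≡ 0` on every DOWN transposition door of some `W`, which no theorem
forbids; or DOWN doors of density `0` for a `W` whose `Ш(W)[2]` is strict at every transposition prime (impossible by Chebotarev applied to the `Ш`-torsor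
fields? — unproved here). [cite: MazurRubin2010, Prop. 3.3 and Lemma 2.11] [cite: Kramer1981, Prop. 3] [cite: OnoSkinner1998, Cor. 3] -/
@[conjecture] def TranspShaSpinDoorExistsAtTwo : Prop :=
  ∀ (W : WeierstrassCurve ℚ) [W.IsElliptic] [W.IsGloballyMinimal] [NeZero (W.conductorNorm ℤ)],
    ¬ W.HasCM → (∀ n : ℕ, W.HasSurjectiveModNGaloisRep ((2 ^ n : ℕ) : ℤ)) → Odd W.torsionOrder → Odd W.tamagawaProduct →
    W.analyticRank = 1 → W.Δ < 0 → ShaTwoPrimaryCardFour W →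
    ∃ (K : Type) (_ : Field K) (_ : NumberField K) (q₀ : ℕ), IsImaginaryQuadratic K ∧ TranspAdmissible W (NumberField.discr K) q₀ ∧
      SelmerTwoVisibleAtPrime W q₀ ∧ SpinNondegenerateAt W (NumberField.discr K) ∧
      (W.quadraticTwist (NumberField.discr K : ℚ)).entireLFunction 1 ≠ 0

/-- **S2″ `TranspShaDoorHeegnerExponentAtTwo` (CRUX-grade CONJECTURE; DEPTH-TWO Kolyvagin exactness at `2`, `Δ < 0`).**  `W` in the class; `K` imaginary quadratic,
`(d_K, q₀)` transposition-admissible with `Sel₂(W)` visible at `q₀`, spin-nondegenerate, `L(W^{(d_K)},1) ≠ 0`; `Dt` ANY parametrisation datum (constant `c`), `H`, `ι`,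
`P ∈ E(K)` over the complex Heegner point.  THEN the exact `2`-divisibility exponent of `P` modulo torsion is `v₂(c) + 2`.  The one-door law with ONE transverse
place (`q₀`; AN-28c `2m + 1 = s_E + s_d + 1 + 2v₂c` with `s_E = s_d = 2`) = `BSD₂(W) ∧ BSD₂(W^{(d_K)})` read at the door; two storeys above the tree's T-q₀ corollary
(`m = v₂c` at `Sel₂`-trivial transposition doors, `…FirstLayerTranspositionCorollary`).  Why it might fail: Kolyvagin's conjecture at `2` in depth two; the
`2`-part of a non-optimal datum. [cite: Kolyvagin1991structure, Thm. 1.2] [cite: GrossLMS1991, Conj. 1.2, §3 and §10] [cite: GrossZagier1986, Thm. I.6.3 and V.§2] -/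
@[conjecture] def TranspShaDoorHeegnerExponentAtTwo : Prop :=
  ∀ (W : WeierstrassCurve ℚ) [W.IsElliptic] [W.IsGloballyMinimal] [NeZero (W.conductorNorm ℤ)],
    ¬ W.HasCM → (∀ n : ℕ, W.HasSurjectiveModNGaloisRep ((2 ^ n : ℕ) : ℤ)) → Odd W.torsionOrder → Odd W.tamagawaProduct →
    W.analyticRank = 1 → W.Δ < 0 → ShaTwoPrimaryCardFour W →
    ∀ (K : Type) [Field K] [NumberField K] (q₀ : ℕ), IsImaginaryQuadratic K → TranspAdmissible W (NumberField.discr K) q₀ →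
      SelmerTwoVisibleAtPrime W q₀ → SpinNondegenerateAt W (NumberField.discr K) →
      (W.quadraticTwist (NumberField.discr K : ℚ)).entireLFunction 1 ≠ 0 →
      ∀ (Dt : ModularParametrizationData W (W.conductorNorm ℤ))
        (H : HeegnerDatum (W.conductorNorm ℤ) (NumberField.discr K)) (ι : K →+* ℂ)
        (P : (W.baseChange K).toAffine.Point),
        WeierstrassCurve.Affine.Point.map ι.toRatAlgHom P = heegnerPointComplex Dt H →
        HasTwoDivisibilityUpToTorsion W K P (padicValInt 2 Dt.c + 2)

/-- **S3″ `ShaCardFourAtTranspShaSpinDoorAtTwo` (SUPPORT; theorem-grade modulo Selmer algebra).**  At a spin-nondegenerate DOWN transposition door of a `W` of the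
class, a globally minimal model `Wd` of the twist has `#Ш(Wd)[2^∞] = 4`: `#Sel₂(W^{(d)}) = #Sel₂(W)/2 = #Ш(W)[2] = 4` (§1 DOWN count + rank one + the alternating
pairing), `Wd(ℚ)[2] = 0`, `r_4 = 0 ⟹ Sel_{2^∞}(Wd)` finite of order `4` ⟹ rank `0`, `Ш(Wd)[2^∞] = Sel_{2^∞}(Wd)`.  Same honest lemma as ES-44 S3 / ES-45 S3′
(`selmerGroup W 2` versus `selmerGroupPInfty`).  R448c: «the alternating pairing» = Cassels alternation (see `ShaTwoPrimaryCardFour`); without it `Ш(W)[2^∞] ≅ ℤ/4` would give a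
DOWN count `2` and S3″ would be false. [cite: Kramer1981, Prop. 3] [cite: SmithGoldfeld2025, Notation 1.8] [cite: Cassels1962, §3 (the pairing on Ш is alternating; kernel = divisible part)] [cite: MilneADT2006, Thm. I.6.13, Cor. I.6.14] -/
@[conjecture] def ShaCardFourAtTranspShaSpinDoorAtTwo : Prop :=
  ∀ (W : WeierstrassCurve ℚ) [W.IsElliptic] [W.IsGloballyMinimal] [NeZero (W.conductorNorm ℤ)],
    ¬ W.HasCM → (∀ n : ℕ, W.HasSurjectiveModNGaloisRep ((2 ^ n : ℕ) : ℤ)) → Odd W.torsionOrder → Odd W.tamagawaProduct →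
    W.analyticRank = 1 → W.Δ < 0 → ShaTwoPrimaryCardFour W →
    ∀ (d : ℤ) (q₀ : ℕ), TranspAdmissible W d q₀ → SelmerTwoVisibleAtPrime W q₀ → SpinNondegenerateAt W d →
      ∀ (Wd : WeierstrassCurve ℚ) [Wd.IsElliptic] [Wd.IsGloballyMinimal] (Cd : WeierstrassCurve.VariableChange ℚ),
        Cd • W.quadraticTwist (d : ℚ) = Wd → Nat.card (AddCommGroup.primaryComponent Wd.sha 2) = 4

theorem padicValNat_two_four' : padicValNat 2 4 = 2 := by
  rw [show (4 : ℕ) = 2 ^ 2 by norm_num, padicValNat.prime_pow]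

/-- **KERNEL REDUCTION (PROVED): modularity + S1″ + S2″ + S3″ ⟹ `R_S|{Δ<0, #Ш[2^∞]=4}`.**  The chosen DOWN spin door is door-admissible and minimal with ONE
transverse place (`ANg16.doorAdmissible_of_transpAdmissible`, `minimal_of_transpAdmissible`), Heegner for `N_W` and coprime to it; S2″ supplies the exponent
`v₂(c) + 2`, S3″ the twin's `#Ш[2^∞] = 4`, and the lawful-door arithmetic `2(v₂c + 2) + 1 = 2 + 2 + 1 + 2v₂c` closes by `omega`.  BSD is not proved by this:
S1″/S2″ are conjectures. -/
theorem residueShaTranspFour_of_transpShaSpinDoors (hnf : exists_isNewformOf)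
    (h1 : TranspShaSpinDoorExistsAtTwo) (h2 : TranspShaDoorHeegnerExponentAtTwo) (h3 : ShaCardFourAtTranspShaSpinDoorAtTwo) :
    DoorIndexLawFullCAtTwoSomeDoorResidueShaTranspFour := by
  intro W _ _ _ hCM hsurj hT hc hr hΔ h4
  haveI : Fact (Nat.Prime 2) := ⟨Nat.prime_two⟩
  obtain ⟨K, iF, iN, q₀, hK, htr, hvis, hspin, hLt⟩ := h1 W hCM hsurj hT hc hr hΔ h4
  have hadm : DoorAdmissible W (NumberField.discr K) := ANg16.doorAdmissible_of_transpAdmissible W htr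
  have hmin : transpCount W (NumberField.discr K) + 2 * identCount W (NumberField.discr K) = (if W.Δ < 0 then 1 else 0) :=
    minimal_of_transpAdmissible W htr hΔ
  have hif : (if W.Δ < 0 then 1 else 0 : ℕ) = 1 := if_pos hΔ
  have hHN : SatisfiesHeegnerHypothesis (W.conductorNorm ℤ) K := satisfiesHeegnerHypothesis_of_doorAdmissible W K hK hadm
  obtain ⟨Dt⟩ := (nonempty_modularParametrizationData_iff_exists_isNewformOf_unconditional.mpr hnf) W
  obtain ⟨H, -⟩ :=
    nonempty_heegnerDatum_holds (W.conductorNorm ℤ) K hK (exists_dvd_sq_sub_discr_holds (W.conductorNorm ℤ) K hK hHN).choose_spec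
  obtain ⟨ι⟩ : Nonempty (K →+* ℂ) := inferInstance
  obtain ⟨P, hP⟩ := heegnerPointComplex_mem_range_map_holds (W.conductorNorm ℤ) W K hK hHN Dt H ι
  have hm : HasTwoDivisibilityUpToTorsion W K P (padicValInt 2 Dt.c + 2) :=
    h2 W hCM hsurj hT hc hr hΔ h4 K q₀ hK htr hvis hspin hLt Dt H ι P hP
  have hD0 : (NumberField.discr K : ℚ) ≠ 0 := by exact_mod_cast NumberField.discr_ne_zero K
  haveI hEt : (W.quadraticTwist (NumberField.discr K : ℚ)).IsElliptic := W.isElliptic_quadraticTwist hD0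
  obtain ⟨Cd, hCd⟩ := hasGlobalMinimalModel_rat_holds (W.quadraticTwist (NumberField.discr K : ℚ))
  haveI := hCd
  have hsW : padicValNat 2 (Nat.card (AddCommGroup.primaryComponent W.sha 2)) = 2 := by
    rw [show Nat.card (AddCommGroup.primaryComponent W.sha 2) = 4 from h4]; exact padicValNat_two_four'
  have hsd : padicValNat 2 (Nat.card (AddCommGroup.primaryComponent (Cd • W.quadraticTwist (NumberField.discr K : ℚ)).sha 2)) = 2 := by
    rw [h3 W hCM hsurj hT hc hr hΔ h4 (NumberField.discr K) q₀ htr hvis hspin (Cd • W.quadraticTwist (NumberField.discr K : ℚ)) Cd rfl]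
    exact padicValNat_two_four'
  unfold HasLawfulDoorAtTwo
  refine ⟨K, iF, iN, hK, hadm, hLt, Dt, H, ι, P, Cd • W.quadraticTwist (NumberField.discr K : ℚ), inferInstance, hCd, Cd, hP, rfl,
    padicValInt 2 Dt.c + 2, hm, ?_⟩
  rw [hsW, hsd, hif]
  rw [hif] at hmin
  omega

/-- Bookkeeping (proved): S1″ hands the census its door — a transposition-admissible `d` with a visible `q₀`, `β = 1` and `L ≠ 0`. -/
theorem exists_spinNondegenerate_transpDoor_of_S1'' (h1 : TranspShaSpinDoorExistsAtTwo)
    (W : WeierstrassCurve ℚ) [W.IsElliptic] [W.IsGloballyMinimal] [NeZero (W.conductorNorm ℤ)]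
    (hCM : ¬ W.HasCM) (hsurj : ∀ n : ℕ, W.HasSurjectiveModNGaloisRep ((2 ^ n : ℕ) : ℤ)) (hT : Odd W.torsionOrder)
    (hc : Odd W.tamagawaProduct) (hr : W.analyticRank = 1) (hΔ : W.Δ < 0) (h4 : ShaTwoPrimaryCardFour W) :
    ∃ (d : ℤ) (q₀ : ℕ), TranspAdmissible W d q₀ ∧ SelmerTwoVisibleAtPrime W q₀ ∧ SpinNondegenerateAt W d ∧
      (W.quadraticTwist (d : ℚ)).entireLFunction 1 ≠ 0 := by
  obtain ⟨K, _, _, q₀, -, htr, hvis, hspin, hL⟩ := h1 W hCM hsurj hT hc hr hΔ h4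
  exact ⟨NumberField.discr K, q₀, htr, hvis, hspin, hL⟩

end Summit.BirchSwinnertonDyer.BirchSwinnertonDyer.Theorems.RankOneAtTwoShaTranspositionAtTwo

end
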